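import Literature.IUT.LogVolume.Corollary22Statement
import Literature.NumberTheory.DiophantineGeometry.GenEllThm21
import HarnessLib

/-!
# [IUTchIV] Corollary 2.3 (Diophantine Inequalities): its proof as a kernel-checked chain
# `Cor. 2.2 ⟹ [GenEll] Thm. 2.1 (ii) for Σ = {2} ⟹ (Thm. 2.1 (i), the abc sentence)`

Mochizuki, *Inter-universal Teichmüller theory IV*, RIMS manuscript (Apr. 2020; = PRIMS **57** (2021)),
Cor. 2.3, statement p. 54, proof pp. 54–55. TAKES NO SIDE on the disputed step: Corollary 2.2 (whose proof
applies Theorem 1.10, which rests on [IUTchIII] Cor. 3.12) enters as the HYPOTHESIS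
`Cor22.Corollary22 H_unif` (typed in `Corollary22Statement.lean`), never asserted.

Printed proof (pp. 54–55): "the content of the statement of Corollary 2.3 coincides precisely with the
content of [GenEll], Theorem 2.1, (i). Thus, it follows from the equivalence of [GenEll], Theorem 2.1,
that … it suffices to verify that [GenEll], Theorem 2.1, (ii), holds. That is to say, we may assume … that
`X = ℙ¹_ℚ` …; `D` … “0”, “1”, “∞”; `K_V ⊆ U_X(ℚ̄)` is a compactly bounded subset whose support contains
the nonarchimedean prime “2”; `K_V` satisfies the condition “(∗^{j-inv})” of Corollary 2.2. [Here, we note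
… that this condition only concerns the behavior of `K_V ∩ U_X(ℚ̄)^{≤d}` as `d` varies; that is to say,
this condition is entirely vacuous in situations, i.e., such as the situation considered in [GenEll],
Theorem 2.1, (ii), in which one is only concerned with `K_V ∩ U_X(ℚ̄)^{≤d}` for a fixed `d`.] Then it
suffices to show that the inequality of BD-classes … `ht_{ω_X(D)} ≲ (1+ε)(log-diff_X + log-cond_D)` holds on
`K_V ∩ U_X(ℚ̄)^{≤d}`. But such an inequality follows immediately, in light of … Corollary 2.2, (i), from
Corollary 2.2, (ii) [cf. condition (C2)], (iii)".

Kernel content (over the tree's [GenEll] vocabulary of abc-iut-S4: `VojtaIneq`, `ABCCompactlyBounded`,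
`VojtaP1Deg`, `GenEll_thm21`, `abc_of_abcCompactlyBounded`):
* `vojtaIneq_of_corollary22` — for a `K_V` satisfying the hypotheses of Cor. 2.2, (i)+(ii)+(iii) give
  `VojtaIneq K_V d ε` for every `d ≥ 1`, `ε > 0` (= `Cor22.bdLe_of_corollary22`, by name);
* `JInvVacuous` — the bracketed vacuity remark as a NAMED INPUT: for fixed `d`, a compactly bounded `K_V`
  whose support contains `2` may be replaced by one satisfying (∗^{j-inv}) without losing points of degree
  `≤ d` (classical: finitely many extensions of `ℚ₂` of degree `≤ d`, on each of which `j` is bounded on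
  the compact domain `K_2 ∩ X(K)`; shrink `K_2` to `K_2 ∩ {|j| ≤ C_d}`, a clopen cut). Not proved here;
* `abcCompactlyBounded_two_of_corollary22` — `Corollary22 H_unif → JInvVacuous → ABCCompactlyBounded {2}`,
  i.e. hypothesis (ii) of [GenEll] Thm. 2.1 for `Σ = {2}`, PROVED;
* `vojtaP1Deg_of_corollary22` — adding the NAMED FACT `GenEll_thm21` ((ii) ⟹ (i), noncritical Belyi
  maps): Cor. 2.3 for `(ℙ¹_ℚ, {0,1,∞})` and every `d`, PROVED as an implication;
* `abc_of_corollary22` — the abc sentence for coprime triples, PROVED as an implication from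
  `Corollary22 H_unif`, `JInvVacuous`, `GenEll_thm21` (via S4's `abc_of_abcCompactlyBounded`).

Deliberately NOT here: Cor. 2.3 for general hyperbolic curves (`TODO(general form)` in `GenEllThm21.lean`);
any proof of Cor. 2.2; any judgement on Cor. 3.12.
-/

noncomputable section

namespace Literature.IUT.LogVolume

namespace Cor22

open Literature.NumberTheory.DiophantineGeometry Literature.NumberTheory.DiophantineGeometry.GenEll

/-- The Cor. 2.2 step of the proof of Cor. 2.3 (p. 55), in the tree's [GenEll] vocabulary: for `K_V`
satisfying the hypotheses of Cor. 2.2, parts (i), (ii), (iii) give `ht_{ω_P(C)} ≲ (1+ε)(log-diff + log-cond)`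
on `K_V ∩ U_P(ℚ̄)^{≤d}` for every `d ≥ 1`, `ε > 0`. [claim: Mochizuki2012, status: disputed] -/
theorem vojtaIneq_of_corollary22 {D : CBData} {Hunif : ℝ} (hI : PartI D) (hII : PartII D Hunif)
    (hIII : PartIII D Hunif) {d : ℕ} (hd : 0 < d) {ε : ℝ} (hε : 0 < ε) : VojtaIneq D.toSet d ε :=
  bdLe_of_corollary22 hI hII hIII hd hε

/-- The bracketed remark of the proof of Cor. 2.3 (p. 55) as a NAMED INPUT: "[the condition
“(∗^{j-inv})”] only concerns the behavior of `K_V ∩ U_X(ℚ̄)^{≤d}` as `d` varies; … this condition is entirely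
vacuous in situations … in which one is only concerned with `K_V ∩ U_X(ℚ̄)^{≤d}` for a fixed `d`" — i.e.
for fixed `d`, a compactly bounded `K_V` whose support contains `2` can be replaced by a compactly bounded
`K'_V` satisfying the hypotheses of Cor. 2.2 and containing all points of `K_V` of degree `≤ d`. (Classical:
there are finitely many extensions `K/ℚ₂` of degree `≤ d`, `j` is bounded on each compact domain
`K_2 ∩ X(K)`, and `K_2 ∩ {|j|_2 ≤ C}` is again a Galois-stable compact domain; not proved in this file.)
[claim: Mochizuki2012, status: disputed] -/
def JInvVacuous : Prop :=
  ∀ D : CBData, D.SupportContains {2} → ∀ d : ℕ, 0 < d →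
    ∃ D' : CBData, Hypotheses D' ∧ D.toSet ∩ UPle d ⊆ D'.toSet

/-- **Cor. 2.2 ⟹ [GenEll] Thm. 2.1 (ii) for `Σ = {2}`** (the proof of Cor. 2.3, p. 55, minus the final
appeal to [GenEll] Thm. 2.1): PROVED as an implication from `Corollary22 H_unif` and the vacuity input.
[claim: Mochizuki2012, status: disputed] -/
theorem abcCompactlyBounded_two_of_corollary22 {Hunif : ℝ} (h22 : Corollary22 Hunif)
    (hvac : JInvVacuous) : ABCCompactlyBounded {2} := by
  intro d hd ε hε D hD
  obtain ⟨D', hD', hsub⟩ := hvac D hD d hd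
  obtain ⟨hI, hII, hIII⟩ := h22.2 D' hD'
  have h := vojtaIneq_of_corollary22 hI hII hIII hd hε
  unfold VojtaIneq at h ⊢
  exact h.mono fun P hP => ⟨hsub hP, hP.2⟩

/-- **[IUTchIV] Corollary 2.3 for `(ℙ¹_ℚ, {0,1,∞})` and every degree `d`** ("the content of the statement of
Corollary 2.3 coincides precisely with the content of [GenEll], Theorem 2.1, (i)"), PROVED as an implication:
`Corollary22 H_unif → JInvVacuous → GenEll_thm21 → ∀ d ≥ 1, VojtaP1Deg d`. RETIRED (audit A-Sd2-F1): takes the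
abc-strength `GenEll_thm21`; the declaration of record is `vojtaP1Deg_of_corollary22_primes` below.
[claim: Mochizuki2012, status: disputed] -/
theorem vojtaP1Deg_of_corollary22 {Hunif : ℝ} (h22 : Corollary22 Hunif) (hvac : JInvVacuous)
    (hfact : GenEll_thm21) {d : ℕ} (hd : 0 < d) : VojtaP1Deg d :=
  vojtaP1Deg_of_abcCompactlyBounded_two hfact (abcCompactlyBounded_two_of_corollary22 h22 hvac) hd

/-- **The campaign-S endpoint at the level of [IUTchIV] §2**: the abc sentence for coprime triples,
`∀ ε > 0 ∃ C > 0, c < C·rad(abc)^{1+ε}`, as a kernel-checked implication from `Corollary22 H_unif`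
(typed, disputed — its proof applies Theorem 1.10, which rests on [IUTchIII] Cor. 3.12), the printed
vacuity remark `JInvVacuous`, and the named fact `GenEll_thm21` ([GenEll] Thm. 2.1 (ii) ⟹ (i)).
Nothing is asserted unconditionally. RETIRED (audit A-Sd2-F1): takes the abc-strength `GenEll_thm21`; the
declaration of record is `abc_of_corollary22_primes` below. [claim: Mochizuki2012, status: disputed] -/
theorem abc_of_corollary22 {Hunif : ℝ} (h22 : Corollary22 Hunif) (hvac : JInvVacuous)
    (hfact : GenEll_thm21) :
    ∀ ε : ℝ, 0 < ε → ∃ C : ℝ, 0 < C ∧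
      ∀ a b c : ℕ, IsABCTriple a b c → (c : ℝ) < C * ((rad a b c : ℕ) : ℝ) ^ (1 + ε) :=
  abc_of_abcCompactlyBounded_two hfact (abcCompactlyBounded_two_of_corollary22 h22 hvac)


/-! ## The same endpoint over the FAITHFUL named fact `GenEll_thm21_primes` (audit A-Sd2-F1, append-only
repair): [GenEll] Thm. 2.1 reads "Let `Σ` be a finite set of prime numbers"; `GenEll_thm21` (without that
binder) is abc-strength by vacuity and is RETIRED; the theorems below are the declarations of record. -/

/-- **[IUTchIV] Corollary 2.3 for `(ℙ¹_ℚ, {0,1,∞})` and every degree `d` — DECLARATION OF RECORD**: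
`Corollary22 H_unif → JInvVacuous → GenEll_thm21_primes → ∀ d ≥ 1, VojtaP1Deg d`, the named fact being the
faithful transcription of [GenEll] Thm. 2.1 ((ii) ⟹ (i) for finite sets of PRIME numbers), applied at
`Σ = {2}`. [claim: Mochizuki2012, status: disputed] -/
theorem vojtaP1Deg_of_corollary22_primes {Hunif : ℝ} (h22 : Corollary22 Hunif) (hvac : JInvVacuous)
    (hfact : GenEll_thm21_primes) {d : ℕ} (hd : 0 < d) : VojtaP1Deg d :=
  vojtaP1Deg_of_abcCompactlyBounded_two_primes hfact (abcCompactlyBounded_two_of_corollary22 h22 hvac) hd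

/-- **The campaign-S endpoint at the level of [IUTchIV] §2 — DECLARATION OF RECORD**: the abc sentence
for coprime triples as a kernel-checked implication from `Corollary22 H_unif` (typed, disputed), the
printed vacuity remark `JInvVacuous`, and the FAITHFUL named fact `GenEll_thm21_primes` ([GenEll]
Thm. 2.1 (ii) ⟹ (i) for finite sets of prime numbers). Nothing is asserted unconditionally.
[claim: Mochizuki2012, status: disputed] -/
theorem abc_of_corollary22_primes {Hunif : ℝ} (h22 : Corollary22 Hunif) (hvac : JInvVacuous)
    (hfact : GenEll_thm21_primes) :
    ∀ ε : ℝ, 0 < ε → ∃ C : ℝ, 0 < C ∧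
      ∀ a b c : ℕ, IsABCTriple a b c → (c : ℝ) < C * ((rad a b c : ℕ) : ℝ) ^ (1 + ε) :=
  abc_of_abcCompactlyBounded_two_primes hfact (abcCompactlyBounded_two_of_corollary22 h22 hvac)

end Cor22

end Literature.IUT.LogVolume

end
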